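import Literature.Topology.FourManifolds.DomeModel
import Literature.Topology.FourManifolds.SweepFace
import Literature.Topology.FourManifolds.CappedBallData
import Literature.Topology.FourManifolds.SchoenfliesTools
import HarnessLib

/-!
# The model sweep: the standard sweep function transported along the model parametrisation

Topic `Literature/Topology/FourManifolds`; fact seat of Alexander's theorem
(`provefact-Literature.Topology.FourManifolds.SphereEmbedding.schoenflies_exists_ball`, Schultens
(2014), Thm. 3.2.5).  **Everything in this file is proved; no definitions, no named facts.**

In the absorption of the ball `B` of the inductive step (Schultens (2014), Lemma 3.2.3 and proof
of Thm. 3.2.5, PDF pp. 42–45) the sweep of `SweepLemma.lean` is guided near `B` by the function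
`w = H ∘ Ψ⁻¹`, `H = w_std ∘ Φ_M`, where `Φ_M : 𝔻̄ ≅ M` is the radial parametrisation of the
explicit model solid `M = {F_M ≤ 0}` of `DomeModel.lean` and `w_std` the standard sweep
function of `SweepFace.lean`.  This file proves the facts about the model that the sweep needs:

* §1 calculus tools: the derivative of a diffeomorphism of a finite-dimensional space is a
  linear isomorphism (`exists_fderiv_eq_equiv`), and the corresponding cancellation lemmas;
* §2 `ModelSweep.wstd_conormal` — **the model conormal condition**: at a zero `q` of `F_M` with
  `w_std q ≤ 1 + 3δ₀` (`3δ₀ < (s/2 + λ)/κ` excludes the apex), `Dw_std(q)` is not a nonnegative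
  multiple of `DF_M(q)` (off the axis by `SweepFace.fderiv_wstd_ne_smul` since `DF_M` has a
  nonnegative `dρ²`-component; on the axis the only candidate is the apex);
* §3 `ModelSweep.fderiv_comp_ne_zero`, `ModelSweep.comp_conormal` — the transported function
  `H = w_std ∘ Φ_M` has no critical points, and at unit vectors `y` with `H y ≤ 1 + 3δ₀` its
  differential is not a nonnegative multiple of `⟪y, ·⟫` (the conormal of the unit ball);
* §4 the zone: `(Φ_M y)₂ = -s/2 + μ(y) y₂` with `s/8 ≤ μ ≤ 3`, so points of `M` at height
  `≥ -s/4` come from `y₂ ≥ s/12`, and `y₂ ≥ s/16` lands above height `-s/2`;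
* §5 agreement of the solids: under the standard-face condition for `F_B` (the signs of `F_B`
  and of the lid function agree on the lid zone) `M ⊆ B = {F_B ≤ 0}`, and above height `-s/2`
  inside the lid zone the signs of `F_B` and `F_M` agree.

## References
* J. Schultens, *Introduction to 3-Manifolds*, GSM 151, AMS (2014), Lemma 3.2.3, Thm. 3.2.5
  (PDF pp. 42–45).
-/

noncomputable section

open Set Metric Filter Topology Function
open scoped ContDiff RealInnerProductSpace Manifold

namespace Literature.Topology.FourManifolds.ModelSweep

open CappedBallLid SweepFace DomeModel

/-! ### §1 Calculus tools -/

section Tools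

variable {E : Type*} [NormedAddCommGroup E] [NormedSpace ℝ E]

/-- **The derivative of a diffeomorphism is a linear isomorphism.** [folklore] -/
theorem exists_fderiv_eq_equiv (Φ : E ≃ₘ⟮𝓘(ℝ, E), 𝓘(ℝ, E)⟯ E) (x : E) :
    ∃ L : E ≃L[ℝ] E, (L : E →L[ℝ] E) = fderiv ℝ Φ x := by
  have hΦ : ContDiff ℝ ∞ Φ := contMDiff_iff_contDiff.1 Φ.contMDiff
  have hΦs : ContDiff ℝ ∞ Φ.symm := contMDiff_iff_contDiff.1 Φ.symm.contMDiff
  have h1 : HasFDerivAt Φ (fderiv ℝ Φ x) x := ((hΦ.differentiable (by simp)) x).hasFDerivAt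
  have h2 : HasFDerivAt Φ.symm (fderiv ℝ Φ.symm (Φ x)) (Φ x) :=
    ((hΦs.differentiable (by simp)) (Φ x)).hasFDerivAt
  have hc1 : HasFDerivAt (Φ.symm ∘ Φ) ((fderiv ℝ Φ.symm (Φ x)).comp (fderiv ℝ Φ x)) x := h2.comp x h1
  have hc1' : (fderiv ℝ Φ.symm (Φ x)).comp (fderiv ℝ Φ x) = ContinuousLinearMap.id ℝ E := by
    have hid : HasFDerivAt (Φ.symm ∘ Φ) (ContinuousLinearMap.id ℝ E) x := by
      have : (Φ.symm ∘ Φ : E → E) = id := by funext y; simp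
      rw [this]; exact hasFDerivAt_id x
    exact hc1.unique hid
  have h1' : HasFDerivAt Φ (fderiv ℝ Φ (Φ.symm (Φ x))) (Φ.symm (Φ x)) := by
    rw [Φ.symm_apply_apply]; exact h1
  have hc2 : HasFDerivAt (Φ ∘ Φ.symm) ((fderiv ℝ Φ x).comp (fderiv ℝ Φ.symm (Φ x))) (Φ x) := by
    have := h1'.comp (Φ x) h2
    rw [Φ.symm_apply_apply] at this
    exact this
  have hc2' : (fderiv ℝ Φ x).comp (fderiv ℝ Φ.symm (Φ x)) = ContinuousLinearMap.id ℝ E := by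
    have hid : HasFDerivAt (Φ ∘ Φ.symm) (ContinuousLinearMap.id ℝ E) (Φ x) := by
      have : (Φ ∘ Φ.symm : E → E) = id := by funext y; simp
      rw [this]; exact hasFDerivAt_id (Φ x)
    exact hc2.unique hid
  refine ⟨ContinuousLinearEquiv.equivOfInverse (fderiv ℝ Φ x) (fderiv ℝ Φ.symm (Φ x))
    (fun v => ?_) (fun v => ?_), rfl⟩
  · have := congrArg (fun T : E →L[ℝ] E => T v) hc1'
    simpa using this
  · have := congrArg (fun T : E →L[ℝ] E => T v) hc2'
    simpa using this

/-- **The derivative of a local diffeomorphism given by an inverse pair is a linear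
isomorphism.** [folklore] -/
theorem exists_fderiv_eq_equiv_of_inverse {Ψ Ψinv : E → E} {U : Set E} (hU : IsOpen U)
    (hΨ : ContDiffOn ℝ ∞ Ψ U) (hV : IsOpen (Ψ '' U)) (hΨinv : ContDiffOn ℝ ∞ Ψinv (Ψ '' U))
    (hleft : ∀ y ∈ U, Ψinv (Ψ y) = y) {y : E} (hy : y ∈ U) :
    ∃ L : E ≃L[ℝ] E, (L : E →L[ℝ] E) = fderiv ℝ Ψ y ∧ (L.symm : E →L[ℝ] E) = fderiv ℝ Ψinv (Ψ y) := by
  have hright : ∀ z ∈ Ψ '' U, Ψ (Ψinv z) = z := by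
    rintro _ ⟨y', hy', rfl⟩; rw [hleft y' hy']
  have hyV : Ψ y ∈ Ψ '' U := ⟨y, hy, rfl⟩
  have h1 : HasFDerivAt Ψ (fderiv ℝ Ψ y) y :=
    ((hΨ.differentiableOn (by simp)).differentiableAt (hU.mem_nhds hy)).hasFDerivAt
  have h2 : HasFDerivAt Ψinv (fderiv ℝ Ψinv (Ψ y)) (Ψ y) :=
    ((hΨinv.differentiableOn (by simp)).differentiableAt (hV.mem_nhds hyV)).hasFDerivAt
  have hc1 : HasFDerivAt (Ψinv ∘ Ψ) ((fderiv ℝ Ψinv (Ψ y)).comp (fderiv ℝ Ψ y)) y := h2.comp y h1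
  have hc1' : (fderiv ℝ Ψinv (Ψ y)).comp (fderiv ℝ Ψ y) = ContinuousLinearMap.id ℝ E := by
    have hid : HasFDerivAt (Ψinv ∘ Ψ) (ContinuousLinearMap.id ℝ E) y := by
      refine (hasFDerivAt_id y).congr_of_eventuallyEq ?_
      filter_upwards [hU.mem_nhds hy] with y' hy'
      simp [hleft y' hy']
    exact hc1.unique hid
  have h1' : HasFDerivAt Ψ (fderiv ℝ Ψ (Ψinv (Ψ y))) (Ψinv (Ψ y)) := by rw [hleft y hy]; exact h1
  have hc2 : HasFDerivAt (Ψ ∘ Ψinv) ((fderiv ℝ Ψ y).comp (fderiv ℝ Ψinv (Ψ y))) (Ψ y) := by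
    have := h1'.comp (Ψ y) h2
    rw [hleft y hy] at this
    exact this
  have hc2' : (fderiv ℝ Ψ y).comp (fderiv ℝ Ψinv (Ψ y)) = ContinuousLinearMap.id ℝ E := by
    have hid : HasFDerivAt (Ψ ∘ Ψinv) (ContinuousLinearMap.id ℝ E) (Ψ y) := by
      refine (hasFDerivAt_id (Ψ y)).congr_of_eventuallyEq ?_
      filter_upwards [hV.mem_nhds hyV] with z hz
      simp [hright z hz]
    exact hc2.unique hid
  refine ⟨ContinuousLinearEquiv.equivOfInverse (fderiv ℝ Ψ y) (fderiv ℝ Ψinv (Ψ y))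
    (fun v => ?_) (fun v => ?_), rfl, rfl⟩
  · have := congrArg (fun T : E →L[ℝ] E => T v) hc1'
    simpa using this
  · have := congrArg (fun T : E →L[ℝ] E => T v) hc2'
    simpa using this

/-- Cancelling a linear isomorphism on the right of an equation between functionals. [folklore] -/
theorem comp_equiv_eq_smul_iff (L : E ≃L[ℝ] E) (a b : E →L[ℝ] ℝ) (c : ℝ) :
    a.comp (L : E →L[ℝ] E) = c • b.comp (L : E →L[ℝ] E) ↔ a = c • b := by
  constructor
  · intro h
    ext v
    have := congrArg (fun T : E →L[ℝ] ℝ => T (L.symm v)) h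
    simpa using this
  · intro h; rw [h]; ext v; simp

/-- A functional composed with a linear isomorphism vanishes only if it vanishes. [folklore] -/
theorem comp_equiv_ne_zero (L : E ≃L[ℝ] E) {a : E →L[ℝ] ℝ} (ha : a ≠ 0) :
    a.comp (L : E →L[ℝ] E) ≠ 0 := by
  intro h
  apply ha
  ext v
  have := congrArg (fun T : E →L[ℝ] ℝ => T (L.symm v)) h
  simpa using this

end Tools

/-! ### §2 The model conormal condition -/

variable {P : ℝ → ℝ} {s : ℝ}

/-- `dρ²` vanishes on the axis. [folklore] -/
theorem dhsq_eq_zero_of_axis {x : EuclideanSpace ℝ (Fin 3)} (h0 : x 0 = 0) (h1 : x 1 = 0) :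
    dhsq x = 0 := by
  ext w; rw [dhsq_apply, h0, h1]; simp

/-- `dz` is the coordinate functional `x ↦ x₂`, equal to `⟪e₂, ·⟫`. [folklore] -/
theorem dz_eq_proj : dz = EuclideanSpace.proj (𝕜 := ℝ) (2 : Fin 3) := rfl

/-- **The model conormal condition.**  At a zero `q` of the model function with
`w_std q ≤ 1 + 3δ₀`, where `3δ₀ < (s/2 + λ)/κ`, the differential of the standard sweep function
is not a nonnegative multiple of `DF_M(q)`. [cite: Schultens2014, Lemma 3.2.3 (PDF p. 43)] -/
theorem wstd_conormal (hP : Admissible P) (hs : 0 < s) (hs1 : s ≤ 1 / 8)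
    {lam κ δ₀ : ℝ} (hlam : 0 < lam) (hκ : 0 < κ) (h3δ : 3 * δ₀ < (s / 2 + lam) / κ)
    {q : EuclideanSpace ℝ (Fin 3)} (hq : FM P s q = 0) (hw : wstd s lam κ q ≤ 1 + 3 * δ₀)
    {c : ℝ} (hc : 0 ≤ c) : fderiv ℝ (wstd s lam κ) q ≠ c • fderiv ℝ (FM P s) q := by
  have hPd := hP.differentiable
  obtain ⟨A, B, hB, hD⟩ := fderiv_FM_eq hPd hP.hPd hs q
  rw [hD, ← dz_eq_proj]
  by_cases hax : hsq q = 0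
  · -- on the axis: `dρ² = 0`, so `κ⁻¹ dz - … = cA dz`, `cA = κ⁻¹ > 0`
    obtain ⟨h0, h1⟩ := (hsq_eq_zero_iff q).1 hax
    have hdh : dhsq q = 0 := dhsq_eq_zero_of_axis h0 h1
    intro h
    have h2 := congrArg (fun L : EuclideanSpace ℝ (Fin 3) →L[ℝ] ℝ => L (EuclideanSpace.single 2 1)) h
    simp only [fderiv_wstd, hdh, smul_zero, sub_zero, add_zero, FunLike.coe_smul,
      Pi.smul_apply, dz_e2, smul_eq_mul, mul_one] at h2
    -- `κ⁻¹ = c * A`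
    have hcA : 0 < c * A := by rw [← h2]; positivity
    have hA : 0 < A := by
      rcases hc.lt_or_eq with hc' | hc'
      · exact pos_of_mul_pos_right hcA hc'.le |> fun h => by nlinarith [hcA]
      · rw [← hc'] at hcA; simp at hcA
    -- radial transversality forces `q₂ > -s/2`
    have htr := fderiv_FM_apply_sub_pos hP.hP0 hP.hP1 hPd hP.hPd hP.hPge hP.hPle hs hs1 hq
    rw [hD, ← dz_eq_proj, hdh, smul_zero, add_zero] at htr
    simp only [FunLike.coe_smul, Pi.smul_apply, dz_apply, smul_eq_mul,
      PiLp.sub_apply, p0_apply_two] at htr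
    have hq2 : -(s / 2) < q 2 := by
      by_contra hle; push Not at hle
      have : A * (q 2 - -(s / 2)) ≤ 0 := mul_nonpos_of_nonneg_of_nonpos hA.le (by linarith)
      linarith
    -- so `q` is a zero of the lid function on the axis: the apex
    have hlid : lidFun P s q = 0 := ((FM_iff_lidFun hP.hP0 hP.hPge hP.hPle hs hq2.le).2.1).1 hq
    have hq2s : q 2 = s := coord_two_eq_of_lidFun_eq_zero hP.hP0 hP.hPle hs (by linarith) hlid h0 h1
    -- but there `w_std = 1 + (s/2 + λ)/κ > 1 + 3δ₀`
    have hwq : wstd s lam κ q = 1 + (s / 2 + lam) / κ := by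
      unfold wstd bowl; rw [hax, hq2s]; ring
    rw [hwq] at hw
    linarith
  · exact fderiv_wstd_ne_smul hlam hκ hax hB hc

/-- The model function is regular on its zero set. [folklore] -/
theorem fderiv_FM_ne_zero (hP : Admissible P) (hs : 0 < s) (hs1 : s ≤ 1 / 8)
    {q : EuclideanSpace ℝ (Fin 3)} (hq : FM P s q = 0) : fderiv ℝ (FM P s) q ≠ 0 := by
  intro h
  have := fderiv_FM_apply_sub_pos hP.hP0 hP.hP1 hP.differentiable hP.hPd hP.hPge hP.hPle hs hs1 hq
  rw [h] at this; simp at this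

/-! ### §3 The transported function `H = w_std ∘ Φ_M` -/

section Transport

variable (Φ : EuclideanSpace ℝ (Fin 3) ≃ₘ⟮𝓘(ℝ, EuclideanSpace ℝ (Fin 3)), 𝓘(ℝ, EuclideanSpace ℝ (Fin 3))⟯
  EuclideanSpace ℝ (Fin 3))

/-- `H = w_std ∘ Φ` is smooth. [folklore] -/
theorem contDiff_comp (lam κ : ℝ) : ContDiff ℝ ∞ (fun y => wstd s lam κ (Φ y)) :=
  (contDiff_wstd s lam κ).comp (contMDiff_iff_contDiff.1 Φ.contMDiff)

/-- The chain rule for `H = w_std ∘ Φ`. [folklore] -/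
theorem fderiv_comp_eq (lam κ : ℝ) (y : EuclideanSpace ℝ (Fin 3)) :
    fderiv ℝ (fun y => wstd s lam κ (Φ y)) y = (fderiv ℝ (wstd s lam κ) (Φ y)).comp (fderiv ℝ Φ y) := by
  have h1 : DifferentiableAt ℝ (wstd s lam κ) (Φ y) :=
    ((contDiff_wstd s lam κ (n := ∞)).differentiable (by simp)) _
  have h2 : DifferentiableAt ℝ Φ y := ((contMDiff_iff_contDiff.1 Φ.contMDiff).differentiable (by simp)) y
  exact fderiv_comp y h1 h2

/-- **`H = w_std ∘ Φ` has no critical points.** [folklore] -/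
theorem fderiv_comp_ne_zero (lam : ℝ) {κ : ℝ} (hκ : κ ≠ 0) (y : EuclideanSpace ℝ (Fin 3)) :
    fderiv ℝ (fun y => wstd s lam κ (Φ y)) y ≠ 0 := by
  obtain ⟨L, hL⟩ := exists_fderiv_eq_equiv Φ y
  rw [fderiv_comp_eq, ← hL]
  exact comp_equiv_ne_zero L (fderiv_wstd_ne_zero s lam hκ (Φ y))

/-- **The model function pulled back along its parametrisation defines the unit ball**: if
`Φ(𝔻̄) = {F_M ≤ 0}` then `F_M (Φ y) ≤ 0 ↔ ‖y‖ ≤ 1`. [folklore] -/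
theorem comp_nonpos_iff (himg : Φ '' closedBall 0 1 = {x | FM P s x ≤ 0}) (y : EuclideanSpace ℝ (Fin 3)) :
    FM P s (Φ y) ≤ 0 ↔ ‖y‖ ≤ 1 := by
  constructor
  · intro h
    have : Φ y ∈ Φ '' closedBall 0 1 := by rw [himg]; exact h
    obtain ⟨y', hy', he⟩ := this
    rw [Φ.injective he] at hy'
    exact mem_closedBall_zero_iff.1 hy'
  · intro h
    have : Φ y ∈ Φ '' closedBall 0 1 := ⟨y, mem_closedBall_zero_iff.2 h, rfl⟩
    rw [himg] at this; exact this

/-- Likewise for the zero set and the unit sphere. [folklore] -/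
theorem comp_eq_zero_iff (himg : Φ '' sphere 0 1 = {x | FM P s x = 0}) (y : EuclideanSpace ℝ (Fin 3)) :
    FM P s (Φ y) = 0 ↔ ‖y‖ = 1 := by
  constructor
  · intro h
    have : Φ y ∈ Φ '' sphere 0 1 := by rw [himg]; exact h
    obtain ⟨y', hy', he⟩ := this
    rw [Φ.injective he] at hy'
    exact mem_sphere_zero_iff_norm.1 hy'
  · intro h
    have : Φ y ∈ Φ '' sphere 0 1 := ⟨y, mem_sphere_zero_iff_norm.2 h, rfl⟩
    rw [himg] at this; exact this

/-- The squared norm minus one defines the closed unit ball, with differential `2⟪y, ·⟫`.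
[folklore] -/
theorem hasFDerivAt_norm_sq_sub_one (y : EuclideanSpace ℝ (Fin 3)) :
    HasFDerivAt (fun z : EuclideanSpace ℝ (Fin 3) => ‖z‖ ^ 2 - 1) ((2 : ℝ) • innerSL ℝ y) y := by
  have h := (hasStrictFDerivAt_norm_sq y).hasFDerivAt.sub_const 1
  refine h.congr_fderiv ?_
  rw [two_nsmul, two_smul]

/-- **The conormal of the pulled-back model function at the unit sphere is a positive multiple
of `⟪y, ·⟫`.** [folklore] -/
theorem exists_fderiv_comp_FM_eq (hP : Admissible P) (hs : 0 < s) (hs1 : s ≤ 1 / 8)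
    (himgD : Φ '' closedBall 0 1 = {x | FM P s x ≤ 0}) (himgS : Φ '' sphere 0 1 = {x | FM P s x = 0})
    {y : EuclideanSpace ℝ (Fin 3)} (hy : ‖y‖ = 1) :
    ∃ μ : ℝ, 0 < μ ∧ fderiv ℝ (fun z => FM P s (Φ z)) y = μ • innerSL ℝ y := by
  have hFM : ContDiff ℝ ∞ (FM P s) := contDiff_FM hP.hP
  have hG₂ : Differentiable ℝ (fun z => FM P s (Φ z)) :=
    (hFM.comp (contMDiff_iff_contDiff.1 Φ.contMDiff)).differentiable (by simp)
  have hG₁ : Differentiable ℝ (fun z : EuclideanSpace ℝ (Fin 3) => ‖z‖ ^ 2 - 1) := fun z =>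
    (hasFDerivAt_norm_sq_sub_one z).differentiableAt
  have hz₁ : ‖y‖ ^ 2 - 1 = 0 := by rw [hy]; norm_num
  have hz₂ : FM P s (Φ y) = 0 := (comp_eq_zero_iff Φ himgS y).2 hy
  have hy0 : y ≠ 0 := by intro h; rw [h, norm_zero] at hy; norm_num at hy
  have hD₁ : fderiv ℝ (fun z : EuclideanSpace ℝ (Fin 3) => ‖z‖ ^ 2 - 1) y ≠ 0 := by
    rw [(hasFDerivAt_norm_sq_sub_one y).fderiv]
    intro h
    have := congrArg (fun L : EuclideanSpace ℝ (Fin 3) →L[ℝ] ℝ => L y) h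
    simp [hy] at this
  have hD₂ : fderiv ℝ (fun z => FM P s (Φ z)) y ≠ 0 := by
    obtain ⟨L, hL⟩ := exists_fderiv_eq_equiv Φ y
    have h1 : DifferentiableAt ℝ (FM P s) (Φ y) := (hFM.differentiable (by simp)) _
    have h2 : DifferentiableAt ℝ Φ y := ((contMDiff_iff_contDiff.1 Φ.contMDiff).differentiable (by simp)) y
    have hc : fderiv ℝ (fun z => FM P s (Φ z)) y = (fderiv ℝ (FM P s) (Φ y)).comp (fderiv ℝ Φ y) :=
      fderiv_comp y h1 h2
    rw [hc, ← hL]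
    exact comp_equiv_ne_zero L (fderiv_FM_ne_zero hP hs hs1 hz₂)
  have hiff : ∀ᶠ z in 𝓝 y, (‖z‖ ^ 2 - 1 ≤ 0 ↔ FM P s (Φ z) ≤ 0) := by
    refine Filter.Eventually.of_forall fun z => ?_
    rw [comp_nonpos_iff Φ himgD z, sub_nonpos]
    constructor
    · intro h; nlinarith [norm_nonneg z]
    · intro h; nlinarith [norm_nonneg z]
  obtain ⟨μ, hμ, hD⟩ := SchoenfliesTools.exists_pos_fderiv_eq_smul_of_eventually_iff hG₁ hG₂ hz₁ hz₂ hD₁ hD₂ hiff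
  refine ⟨μ * 2, by positivity, ?_⟩
  rw [hD, (hasFDerivAt_norm_sq_sub_one y).fderiv, smul_smul]

/-- **The transported conormal condition.**  If `Φ` parametrises the model solid
(`Φ(𝔻̄) = {F_M ≤ 0}`, `Φ(𝕊) = {F_M = 0}`) then at every unit vector `y` with
`w_std (Φ y) ≤ 1 + 3δ₀` the differential of `H = w_std ∘ Φ` is not a nonnegative multiple of
`⟪y, ·⟫`. [cite: Schultens2014, Lemma 3.2.3 (PDF p. 43)] -/
theorem comp_conormal (hP : Admissible P) (hs : 0 < s) (hs1 : s ≤ 1 / 8)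
    {lam κ δ₀ : ℝ} (hlam : 0 < lam) (hκ : 0 < κ) (h3δ : 3 * δ₀ < (s / 2 + lam) / κ)
    (himgD : Φ '' closedBall 0 1 = {x | FM P s x ≤ 0}) (himgS : Φ '' sphere 0 1 = {x | FM P s x = 0})
    {y : EuclideanSpace ℝ (Fin 3)} (hy : ‖y‖ = 1) (hw : wstd s lam κ (Φ y) ≤ 1 + 3 * δ₀)
    {c : ℝ} (hc : 0 ≤ c) : fderiv ℝ (fun z => wstd s lam κ (Φ z)) y ≠ c • innerSL ℝ y := by
  obtain ⟨μ, hμ, hDμ⟩ := exists_fderiv_comp_FM_eq Φ hP hs hs1 himgD himgS hy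
  have hFM : ContDiff ℝ ∞ (FM P s) := contDiff_FM hP.hP
  have h1 : DifferentiableAt ℝ (FM P s) (Φ y) := (hFM.differentiable (by simp)) _
  have h2 : DifferentiableAt ℝ Φ y := ((contMDiff_iff_contDiff.1 Φ.contMDiff).differentiable (by simp)) y
  have hcomp : fderiv ℝ (fun z => FM P s (Φ z)) y = (fderiv ℝ (FM P s) (Φ y)).comp (fderiv ℝ Φ y) :=
    fderiv_comp y h1 h2
  intro h
  -- `innerSL y = μ⁻¹ DF_M(Φ y) ∘ DΦ(y)`
  have hinner : innerSL ℝ y = μ⁻¹ • (fderiv ℝ (FM P s) (Φ y)).comp (fderiv ℝ Φ y) := by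
    rw [← hcomp, hDμ, smul_smul, inv_mul_cancel₀ hμ.ne', one_smul]
  rw [fderiv_comp_eq, hinner, smul_smul] at h
  obtain ⟨L, hL⟩ := exists_fderiv_eq_equiv Φ y
  rw [← hL] at h
  rw [comp_equiv_eq_smul_iff] at h
  have hz : FM P s (Φ y) = 0 := (comp_eq_zero_iff Φ himgS y).2 hy
  exact wstd_conormal hP hs hs1 hlam hκ h3δ hz hw (by positivity) h

end Transport

/-! ### §4 The zone of the radial model parametrisation -/

section Zone

variable (hP : Admissible P) (hs : 0 < s) (hs1 : s ≤ 1 / 8)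
include hP hs hs1

/-- The profile is at most `3`. [folklore] -/
theorem prof_le_three (y : EuclideanSpace ℝ (Fin 3)) : prof P s y ≤ 3 := by
  by_cases hy : y = 0
  · rw [hy, prof_zero]; linarith
  · rw [prof_of_ne hy]
    obtain ⟨h1, h2, -⟩ := rootFn_spec hP.hP hP.hP0 hP.hP1 hP.hPd hP.hPge hP.hPle hs hs1 hy
    have hn : 0 < ‖y‖ := norm_pos_iff.2 hy
    calc rootFn P s y * ‖y‖ ≤ 3 / ‖y‖ * ‖y‖ := by nlinarith
      _ = 3 := by field_simp

/-- The radial factor `μ(y)` of `Φ_M` lies in `[s/8, 3]`. [folklore] -/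
theorem factor_mem (y : EuclideanSpace ℝ (Fin 3)) :
    s / 8 ≤ RadialBallMap.factor (prof P s) (s / 8) y ∧ RadialBallMap.factor (prof P s) (s / 8) y ≤ 3 := by
  have hprof := isProfile hP.hP hP.hP0 hP.hP1 hP.hPd hP.hPge hP.hPle hs hs1
  exact ⟨RadialBallMap.le_factor hprof y, (RadialBallMap.factor_le hprof y).trans (prof_le_three hP hs hs1 y)⟩

omit hP hs hs1 in
/-- **The height of the model parametrisation**: `(Φ_M y)₂ = -s/2 + μ(y) y₂`. [folklore] -/
theorem rmap_apply_two (y : EuclideanSpace ℝ (Fin 3)) :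
    (RadialBallMap.rmap (p0 s) (prof P s) (s / 8) y) 2 =
      -(s / 2) + RadialBallMap.factor (prof P s) (s / 8) y * y 2 := by
  simp [RadialBallMap.rmap, p0]

/-- **Points of the model at height `≥ -s/4` come from the zone `y₂ ≥ s/12`.** [folklore] -/
theorem zone_of_height {y : EuclideanSpace ℝ (Fin 3)}
    (h : -(s / 4) ≤ (RadialBallMap.rmap (p0 s) (prof P s) (s / 8) y) 2) : s / 12 ≤ y 2 := by
  rw [rmap_apply_two] at h
  obtain ⟨hl, hu⟩ := factor_mem hP hs hs1 y
  set μ := RadialBallMap.factor (prof P s) (s / 8) y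
  have hμ0 : 0 < μ := by linarith
  have h1 : s / 4 ≤ μ * y 2 := by linarith
  have hy2 : 0 < y 2 := by
    by_contra hle; push Not at hle
    have : μ * y 2 ≤ 0 := mul_nonpos_of_nonneg_of_nonpos hμ0.le hle
    linarith
  have : μ * y 2 ≤ 3 * y 2 := by nlinarith
  linarith

/-- **Points of the model at height `≥ -s/2 + η` (`η > 0`) come from the zone `y₂ ≥ η/3`.**
[folklore] -/
theorem zone_of_height' {y : EuclideanSpace ℝ (Fin 3)} {η : ℝ} (hη : 0 < η)
    (h : -(s / 2) + η ≤ (RadialBallMap.rmap (p0 s) (prof P s) (s / 8) y) 2) : η / 3 ≤ y 2 := by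
  rw [rmap_apply_two] at h
  obtain ⟨hl, hu⟩ := factor_mem hP hs hs1 y
  set μ := RadialBallMap.factor (prof P s) (s / 8) y
  have hμ0 : 0 < μ := by linarith
  have h1 : η ≤ μ * y 2 := by linarith
  have hy2 : 0 < y 2 := by
    by_contra hle; push Not at hle
    have : μ * y 2 ≤ 0 := mul_nonpos_of_nonneg_of_nonpos hμ0.le hle
    linarith
  have : μ * y 2 ≤ 3 * y 2 := by nlinarith
  linarith

/-- **The zone `y₂ ≥ s/16` lands strictly above height `-s/2`.** [folklore] -/
theorem height_of_zone {y : EuclideanSpace ℝ (Fin 3)} (h : s / 16 ≤ y 2) :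
    -(s / 2) < (RadialBallMap.rmap (p0 s) (prof P s) (s / 8) y) 2 := by
  rw [rmap_apply_two]
  obtain ⟨hl, -⟩ := factor_mem hP hs hs1 y
  have : 0 < RadialBallMap.factor (prof P s) (s / 8) y * y 2 := by
    apply mul_pos <;> nlinarith
  linarith

/-- Points of positive second coordinate land strictly above height `-s/2`. [folklore] -/
theorem height_of_pos {y : EuclideanSpace ℝ (Fin 3)} (h : 0 < y 2) :
    -(s / 2) < (RadialBallMap.rmap (p0 s) (prof P s) (s / 8) y) 2 := by
  rw [rmap_apply_two]
  obtain ⟨hl, -⟩ := factor_mem hP hs hs1 y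
  have : 0 < RadialBallMap.factor (prof P s) (s / 8) y * y 2 := by
    apply mul_pos <;> nlinarith
  linarith

omit hs1 in
/-- **The model solid lies in the slab `|x₂| ≤ s` and the cylinder `ρ² ≤ (1+s)²`**, hence in the
lid zone. [folklore] -/
theorem bounds_of_FM_nonpos {x : EuclideanSpace ℝ (Fin 3)} (hx : FM P s x ≤ 0) :
    |x 2| ≤ s ∧ hsq x ≤ (1 + s) ^ 2 ∧ x ∈ lidZone s := by
  have h := le_FM hP.hPge hP.hPle hs x (P := P)
  have h1 : |x 2| - s ≤ 0 := (le_max_left _ _).trans (h.trans hx)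
  have h2 : hsq x - (1 + s) ^ 2 ≤ 0 := (le_max_right _ _).trans (h.trans hx)
  refine ⟨by linarith, by linarith, ?_, ?_, ?_⟩
  · show hsq x < (1 + 2 * s) ^ 2; nlinarith
  · show -(5 * s / 2) < x 2; linarith [(abs_le.1 (show |x 2| ≤ s by linarith)).1]
  · show x 2 < 3 * s / 2; linarith [(abs_le.1 (show |x 2| ≤ s by linarith)).2]

end Zone

/-! ### §5 Agreement of the solids `M` and `B` -/

section Agreement

variable (hP : Admissible P) (hs : 0 < s)
  {FB : EuclideanSpace ℝ (Fin 3) → ℝ} (hface : StdFace FB P s)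
include hP hs hface

/-- **Above height `-s/2` in the lid zone the signs of `F_B` and `F_M` agree.** [folklore] -/
theorem sign_iff_FM {x : EuclideanSpace ℝ (Fin 3)} (hz : -(s / 2) ≤ x 2) (hx : x ∈ lidZone s) :
    (FB x ≤ 0 ↔ FM P s x ≤ 0) ∧ (FB x = 0 ↔ FM P s x = 0) ∧ (FB x < 0 ↔ FM P s x < 0) := by
  obtain ⟨h1, h2, h3⟩ := FM_iff_lidFun hP.hP0 hP.hPge hP.hPle hs hz (P := P) (x := x)
  obtain ⟨hn, hp⟩ := hface x hx
  refine ⟨?_, ?_, ?_⟩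
  · rw [h1]
    constructor
    · intro h; by_contra h'; push Not at h'; exact absurd (hp.2 h') (not_lt.2 h)
    · intro h; by_contra h'; push Not at h'; exact absurd (hp.1 h') (not_lt.2 h)
  · rw [h2]
    constructor
    · intro h
      rcases lt_trichotomy (lidFun P s x) 0 with hl | hl | hl
      · exact absurd (hn.2 hl) (by rw [h]; exact lt_irrefl 0)
      · exact hl
      · exact absurd (hp.2 hl) (by rw [h]; exact lt_irrefl 0)
    · intro h
      rcases lt_trichotomy (FB x) 0 with hl | hl | hl
      · exact absurd (hn.1 hl) (by rw [h]; exact lt_irrefl 0)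
      · exact hl
      · exact absurd (hp.1 hl) (by rw [h]; exact lt_irrefl 0)
  · rw [h3]; exact hn

/-- **The model solid lies in `B`**: `F_M x ≤ 0 → F_B x ≤ 0`. [folklore] -/
theorem FB_nonpos_of_FM_nonpos {x : EuclideanSpace ℝ (Fin 3)} (hx : FM P s x ≤ 0) : FB x ≤ 0 := by
  obtain ⟨habs, hh, hLZ⟩ := bounds_of_FM_nonpos hP hs hx
  by_cases hz : -(s / 2) ≤ x 2
  · exact (sign_iff_FM hP hs hface hz hLZ).1.2 hx
  · push Not at hz
    -- below `-s/2`: `F_M ≥ max (G', β) ≥ G' = G`, so `G ≤ 0`, so `F_B ≤ 0`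
    have hb := (FM_bounds hP.hPge hP.hPle hs x (P := P)).1
    have hl' : lid' P s x ≤ 0 := (le_max_left _ _).trans (hb.trans hx)
    have hz2 : -2 * s ≤ x 2 := by linarith [(abs_le.1 habs).1]
    rw [lid'_eq_lidFun hs hz2] at hl'
    obtain ⟨hn, hp⟩ := hface x hLZ
    by_contra h'; push Not at h'
    have := hp.1 h'
    linarith

/-- **The open model solid lies in the interior of `B`**: `F_M x < 0 → F_B x < 0`. [folklore] -/
theorem FB_neg_of_FM_neg {x : EuclideanSpace ℝ (Fin 3)} (hx : FM P s x < 0) : FB x < 0 := by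
  obtain ⟨habs, hh, hLZ⟩ := bounds_of_FM_nonpos hP hs hx.le
  by_cases hz : -(s / 2) ≤ x 2
  · exact (sign_iff_FM hP hs hface hz hLZ).2.2.2 hx
  · push Not at hz
    have hb := (FM_bounds hP.hPge hP.hPle hs x (P := P)).1
    have hl' : lid' P s x < 0 := lt_of_le_of_lt (le_max_left _ _) (lt_of_le_of_lt hb hx)
    have hz2 : -2 * s ≤ x 2 := by linarith [(abs_le.1 habs).1]
    rw [lid'_eq_lidFun hs hz2] at hl'
    exact (hface x hLZ).1.2 hl'

end Agreement

end Literature.Topology.FourManifolds.ModelSweep
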